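import Mathlib
import Summits.Ventures.PercRepro2.SkeletonReduces

/-!
# The path contraction as a reduction (blind cell PercRepro2, night-1 g16; NIGHT1-G16.md §4)

A path `x = vs 0 – vs 1 – … – vs k = y` of nonzero edges `es i = {vs i, vs (i+1)}` through unmarked
interior vertices of nonzero-degree two (`IsPath`) REDUCES, in the relation `Skeleton.Reduces`, to the
single edge `es 0 = {x, y}` of weight `∏ p (es i)` with the other path edges zeroed
(`reduces_of_isPath`): induction on the length, contracting the last interior vertex by one
re-routing and one series move; the product of the weights collects along the way.  Hence every
class theorem of the S-table is closed under the subdivision of its edges.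

Own code; standard axioms.
-/

open scoped Classical

namespace Summit.Ventures.PercRepro2

open UnionCluster CovForm

namespace Skeleton

section Path

variable {V : Type*} {E : Type*} [Fintype E] [DecidableEq E] [Fintype V] [DecidableEq V]
  {R : Type*} [Field R] [LinearOrder R] [IsStrictOrderedRing R]

/-- **A path of nonzero edges through unmarked vertices of nonzero-degree two**: `vs 0, …, vs k`
pairwise distinct, `es i = {vs i, vs (i+1)}` of nonzero weight and pairwise distinct, every
interior vertex `vs i` (`0 < i < k`) unmarked and carrying no nonzero edge but `es (i-1)`, `es i`. -/
structure IsPath (p : E → R) (ends : E → Sym2 V) (o a₁ a₂ a₃ b : V) (k : ℕ) (vs : ℕ → V)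
    (es : ℕ → E) : Prop where
  pos : 1 ≤ k
  ends_eq : ∀ i, i < k → ends (es i) = s(vs i, vs (i + 1))
  nz : ∀ i, i < k → p (es i) ≠ 0
  es_inj : ∀ i j, i < k → j < k → es i = es j → i = j
  vs_inj : ∀ i j, i ≤ k → j ≤ k → vs i = vs j → i = j
  unmarked : ∀ i, 0 < i → i < k → vs i ≠ o ∧ vs i ≠ a₁ ∧ vs i ≠ a₂ ∧ vs i ≠ a₃ ∧ vs i ≠ b
  deg : ∀ i, 0 < i → i < k → ∀ e, p e ≠ 0 → vs i ∈ ends e → e = es (i - 1) ∨ e = es i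

/-- The weights after contracting the path onto its first edge: `es 0 ↦ ∏ p (es i)`, the other path
edges `↦ 0`, everything else unchanged. -/
noncomputable def pathWeight (p : E → R) (es : ℕ → E) (k : ℕ) : E → R :=
  fun e => if e = es 0 then ∏ i ∈ Finset.range k, p (es i)
    else if ∃ i, 0 < i ∧ i < k ∧ e = es i then 0 else p e

omit [Fintype E] [Fintype V] [DecidableEq V] [LinearOrder R] [IsStrictOrderedRing R] in
/-- A path of length one contracts to itself. -/
lemma pathWeight_one (p : E → R) (es : ℕ → E) : pathWeight p es 1 = p := by
  funext e
  unfold pathWeight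
  by_cases h0 : e = es 0
  · subst h0; simp
  · have : ¬ ∃ i, 0 < i ∧ i < 1 ∧ e = es i := by
      rintro ⟨i, hi, hi1, _⟩; omega
    rw [if_neg h0, if_neg this]

variable {o a₁ a₂ a₃ b : V}

omit [Fintype E] [Fintype V] [DecidableEq V] in
/-- **The path contraction is a reduction**: the instance with the path reduces to the instance with
the single edge `es 0 = {vs 0, vs k}` of the product weight. -/
theorem reduces_of_isPath (p : E → R) (ends : E → Sym2 V) (hp : IsProbVec p) (k : ℕ) (vs : ℕ → V)
    (es : ℕ → E) (h : IsPath p ends o a₁ a₂ a₃ b k vs es) :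
    Reduces o a₁ a₂ a₃ b (p, ends)
      (pathWeight p es k, Function.update ends (es 0) s(vs 0, vs k)) := by
  obtain ⟨m, rfl⟩ : ∃ m, k = m + 1 := ⟨k - 1, by have := h.pos; omega⟩
  induction m generalizing p ends vs with
  | zero =>
    rw [pathWeight_one, Function.update_eq_self_iff.2 (h.ends_eq 0 Nat.one_pos).symm]
    exact Relation.ReflTransGen.refl
  | succ k ih =>
    -- the path `vs 0 – … – vs (k+2)`; contract the last interior vertex `vs (k+1)`
    have hk1 : k + 1 < k + 2 := by omega
    have hk0 : k < k + 2 := by omega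
    have hu := h.unmarked (k + 1) (by omega) hk1
    have hvk : vs (k + 1) ≠ vs k := fun hh => by
      have := h.vs_inj _ _ (by omega) (by omega) hh; omega
    have hvk2 : vs (k + 1) ≠ vs (k + 2) := fun hh => by
      have := h.vs_inj _ _ (by omega) (by omega) hh; omega
    have hff : es k ≠ es (k + 1) := fun hh => by
      have := h.es_inj _ _ hk0 hk1 hh; omega
    have hpk : p (es k) ≠ 0 := h.nz k hk0
    have hpk1 : p (es (k + 1)) ≠ 0 := h.nz (k + 1) hk1
    set ends₀ := reroute p ends a₁ with hends₀
    have hagree : ∀ e, p e ≠ 0 → ends e = ends₀ e := fun e he => (reroute_of_ne p ends a₁ he).symm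
    have hnz₀ : ∀ e, vs (k + 1) ∈ ends₀ e → p e ≠ 0 := fun e he =>
      ne_zero_of_mem_reroute p ends hu.2.1 he
    have hf : ends₀ (es k) = s(vs (k + 1), vs k) := by
      rw [← hagree _ hpk, h.ends_eq k hk0]; exact Sym2.eq_swap
    have hf' : ends₀ (es (k + 1)) = s(vs (k + 1), vs (k + 2)) := by
      rw [← hagree _ hpk1, h.ends_eq (k + 1) hk1]
    have hdeg : ∀ e, vs (k + 1) ∈ ends₀ e → e = es k ∨ e = es (k + 1) := by
      intro e he
      have hpe := hnz₀ e he
      rw [← hagree e hpe] at he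
      simpa using h.deg (k + 1) (by omega) hk1 e hpe he
    set p₁ := Function.update (Function.update p (es k) (p (es k) * p (es (k + 1)))) (es (k + 1)) 0
      with hp₁
    set ends₁ := Function.update ends₀ (es k) s(vs k, vs (k + 2)) with hends₁
    have hstep : Reduces o a₁ a₂ a₃ b (p, ends) (p₁, ends₁) :=
      Relation.ReflTransGen.head (Step.reroute hagree)
        (Relation.ReflTransGen.single
          (Step.series hff hf hf' hdeg hvk hvk2 hu.1.symm hu.2.1.symm hu.2.2.1.symm
            hu.2.2.2.1.symm hu.2.2.2.2.symm))
    have hp₁v : IsProbVec p₁ :=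
      (hp.update (es k) (mul_nonneg (hp.nonneg _) (hp.nonneg _))
        (mul_le_one₀ (hp.le_one _) (hp.nonneg _) (hp.le_one _))).update (es (k + 1)) le_rfl
        zero_le_one
    -- the weights of the intermediate instance
    have hp₁_of_ne : ∀ e, e ≠ es k → e ≠ es (k + 1) → p₁ e = p e := fun e h1 h2 => by
      simp [hp₁, Function.update_of_ne h1, Function.update_of_ne h2]
    have hp₁k : p₁ (es k) = p (es k) * p (es (k + 1)) := by
      simp [hp₁, Function.update_of_ne hff]
    have hp₁k1 : p₁ (es (k + 1)) = 0 := by simp [hp₁]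
    -- the shorter path in the intermediate instance
    set vs' : ℕ → V := Function.update vs (k + 1) (vs (k + 2)) with hvs'
    have hvs'_of_ne : ∀ i, i ≠ k + 1 → vs' i = vs i := fun i hi => by
      simp [hvs', Function.update_of_ne hi]
    have hvs'k1 : vs' (k + 1) = vs (k + 2) := by simp [hvs']
    have hpath : IsPath p₁ ends₁ o a₁ a₂ a₃ b (k + 1) vs' es := by
      refine ⟨by omega, ?_, ?_, ?_, ?_, ?_, ?_⟩
      · intro i hi
        by_cases hik : i = k
        · subst hik
          rw [hvs'_of_ne i (by omega), hvs'k1]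
          simp [hends₁]
        · have hi' : i < k := by omega
          have hne : es i ≠ es k := fun hh => hik (h.es_inj _ _ (by omega) hk0 hh)
          rw [hends₁, Function.update_of_ne hne, ← hagree _ (h.nz i (by omega)),
            h.ends_eq i (by omega), hvs'_of_ne i (by omega), hvs'_of_ne (i + 1) (by omega)]
      · intro i hi
        by_cases hik : i = k
        · subst hik; rw [hp₁k]; exact mul_ne_zero hpk hpk1
        · have hne : es i ≠ es k := fun hh => hik (h.es_inj _ _ (by omega) hk0 hh)
          have hne' : es i ≠ es (k + 1) := fun hh => by
            have := h.es_inj _ _ (by omega) hk1 hh; omega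
          rw [hp₁_of_ne _ hne hne']; exact h.nz i (by omega)
      · intro i j hi hj hij; exact h.es_inj i j (by omega) (by omega) hij
      · intro i j hi hj hij
        by_cases hik : i = k + 1 <;> by_cases hjk : j = k + 1
        · omega
        · subst hik; rw [hvs'k1, hvs'_of_ne j hjk] at hij
          have := h.vs_inj _ _ (by omega) (by omega) hij; omega
        · subst hjk; rw [hvs'k1, hvs'_of_ne i hik] at hij
          have := h.vs_inj _ _ (by omega) (by omega) hij; omega
        · rw [hvs'_of_ne i hik, hvs'_of_ne j hjk] at hij
          exact h.vs_inj _ _ (by omega) (by omega) hij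
      · intro i hi0 hi
        rw [hvs'_of_ne i (by omega)]
        exact h.unmarked i hi0 (by omega)
      · intro i hi0 hi e hpe hie
        rw [hvs'_of_ne i (by omega)] at hie
        by_cases hek : e = es k
        · subst hek
          rw [hends₁, Function.update_self] at hie
          rcases Sym2.mem_iff.1 hie with hh | hh
          · right
            have hik : i = k := h.vs_inj i k (by omega) (by omega) hh
            rw [hik]
          · have := h.vs_inj _ _ (by omega) (by omega) hh; omega
        · have hek1 : e ≠ es (k + 1) := fun hh => hpe (by rw [hh, hp₁k1])
          rw [hp₁_of_ne e hek hek1] at hpe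
          rw [hends₁, Function.update_of_ne hek, ← hagree e hpe] at hie
          exact h.deg i hi0 (by omega) e hpe hie
    have hih := ih p₁ ends₁ hp₁v vs' hpath
    rw [hvs'_of_ne 0 (by omega), hvs'k1] at hih
    -- the contracted weights agree
    have hw : pathWeight p₁ es (k + 1) = pathWeight p es (k + 2) := by
      funext e
      unfold pathWeight
      by_cases he0 : e = es 0
      · subst he0
        simp only [if_true]
        rw [Finset.prod_range_succ, Finset.prod_range_succ, Finset.prod_range_succ, hp₁k]
        rw [Finset.prod_congr rfl (fun i hi => hp₁_of_ne (es i)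
          (fun hh => by have := h.es_inj _ _ (by have := Finset.mem_range.1 hi; omega) hk0 hh
                        have := Finset.mem_range.1 hi; omega)
          (fun hh => by have := h.es_inj _ _ (by have := Finset.mem_range.1 hi; omega) hk1 hh
                        have := Finset.mem_range.1 hi; omega))]
        ring
      · simp only [he0, if_false]
        by_cases hex : ∃ i, 0 < i ∧ i < k + 2 ∧ e = es i
        · obtain ⟨i, hi0, hi, rfl⟩ := hex
          have hR : (if ∃ j, 0 < j ∧ j < k + 2 ∧ es i = es j then (0 : R) else p (es i)) = 0 :=
            if_pos ⟨i, hi0, hi, rfl⟩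
          rw [hR]
          by_cases hik : i < k + 1
          · exact if_pos ⟨i, hi0, hik, rfl⟩
          · have hik1 : i = k + 1 := by omega
            subst hik1
            have : ¬ ∃ j, 0 < j ∧ j < k + 1 ∧ es (k + 1) = es j := by
              rintro ⟨j, hj0, hj, hh⟩
              have := h.es_inj _ _ hk1 (by omega) hh; omega
            rw [if_neg this, hp₁k1]
        · have hex' : ¬ ∃ i, 0 < i ∧ i < k + 1 ∧ e = es i := by
            rintro ⟨i, hi0, hi, hh⟩; exact hex ⟨i, hi0, by omega, hh⟩
          rw [if_neg hex, if_neg hex']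
          refine hp₁_of_ne e ?_ (fun hh => hex ⟨k + 1, by omega, by omega, hh⟩)
          intro hh
          by_cases hk : k = 0
          · subst hk; exact he0 hh
          · exact hex ⟨k, by omega, by omega, hh⟩
    rw [hw] at hih
    -- the final re-routing back to `ends`
    have hlast : Step o a₁ a₂ a₃ b
        (pathWeight p es (k + 2), Function.update ends₁ (es 0) s(vs 0, vs (k + 2)))
        (pathWeight p es (k + 2), Function.update ends (es 0) s(vs 0, vs (k + 2))) := by
      refine Step.reroute ?_
      intro e he
      by_cases he0 : e = es 0
      · subst he0; simp
      · rw [Function.update_of_ne he0, Function.update_of_ne he0]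
        have hex : ¬ ∃ i, 0 < i ∧ i < k + 2 ∧ e = es i := by
          intro hex
          apply he
          unfold pathWeight
          simp [he0, hex]
        have hpe : p e ≠ 0 := by
          intro hpe
          apply he
          unfold pathWeight
          simp [he0, hex, hpe]
        have hek : e ≠ es k := by
          intro hh
          by_cases hk : k = 0
          · subst hk; exact he0 hh
          · exact hex ⟨k, by omega, by omega, hh⟩
        rw [hends₁, Function.update_of_ne hek, ← hagree e hpe]
    exact Relation.ReflTransGen.tail (Relation.ReflTransGen.trans hstep hih) hlast

/-- **(HMF) is invariant under the path contraction.** -/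
theorem HMF_iff_of_isPath (p : E → R) (ends : E → Sym2 V) (hp : IsProbVec p) (k : ℕ) (vs : ℕ → V)
    (es : ℕ → E) (h : IsPath p ends o a₁ a₂ a₃ b k vs es) :
    HMF p ends o a₁ a₂ a₃ b ↔
      HMF (pathWeight p es k) (Function.update ends (es 0) s(vs 0, vs k)) o a₁ a₂ a₃ b := by
  have hred := reduces_of_isPath p ends hp k vs es h
  have key := HMF_iff_of_reduces (I := (p, ends))
    (J := (pathWeight p es k, Function.update ends (es 0) s(vs 0, vs k))) hred hp
  exact key

omit [Fintype V] [DecidableEq V] in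
/-- **(HCOV) is invariant under the path contraction.** -/
theorem HCov_iff_of_isPath (p : E → R) (ends : E → Sym2 V) (hp : IsProbVec p) (k : ℕ) (vs : ℕ → V)
    (es : ℕ → E) (h : IsPath p ends o a₁ a₂ a₃ b k vs es) :
    HCov p ends o a₁ a₂ a₃ b ↔
      HCov (pathWeight p es k) (Function.update ends (es 0) s(vs 0, vs k)) o a₁ a₂ a₃ b := by
  have hred := reduces_of_isPath p ends hp k vs es h
  have key := HCov_iff_of_reduces (I := (p, ends))
    (J := (pathWeight p es k, Function.update ends (es 0) s(vs 0, vs k))) hred hp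
  exact key

end Path

end Skeleton

end Summit.Ventures.PercRepro2
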